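import Literature.MathematicalPhysics.QuantumFieldTheory.Balaban1983to89.B9RWSums344InputPair
import Literature.MathematicalPhysics.QuantumFieldTheory.Balaban1983to89.B9Thm310WholeDir

/-!
# `Balaban1983to89.B9RWSums344InputPairGDir` — the (3.44)∕(3.45) input members of Theorem 3.10's sum G(U), per direction pair, OVER THE DIRECTION LETTERS (R1′-A): n06-k's `B9RWSums344InputPair` G-side faces with `Identities310₂`

T. Bałaban, *Propagators for lattice gauge theories in a background field*, Commun. Math. Phys. **99** (1985) 389–434
[`Balaban1985BackgroundPropagators`, "B9"], Thm 3.10 (3.105)–(3.108) pp. 414–416, (3.43)–(3.46) p. 398, (3.42) p. 397, Cor. 3.6 p. 408; T. Bałaban,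
*Propagators and renormalization transformations for lattice gauge theories. II*, Commun. Math. Phys. **96** (1984) 223–250 [`Balaban1984PropagatorsII`, "[4]"],
(2.52)–(2.55) p. 232, Lemma 2.1 p. 234.

statement-level skeleton of published theorems with citation tags; proofs where landed; nothing here is a claim about the
Yang–Mills mass gap

WHY THIS FILE (cell `pub-ymgap`, Track A node N06 [B9], row 19; seat `pub-ymgap-dag-n06-c` g10, LOCATED-9 bus l.32219, R1′-A).  The G-side member faces of
the lineage take `hi : Identities310`; over the direction letters they take `hi : Identities310₂ 𝔬 𝔡 𝔩 R H U` (`B9Thm310WholeDir`) — a TYPE-ONLY re-thread: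
every proof reads `hi` through `inv ∕ invT ∕ eq3105 ∕ eq3105T` only, which `Identities310₂` keeps verbatim.  v1 private helpers are copied (private there);
statements, constants and every other hypothesis VERBATIM.

HONEST SCOPE.  Majorant bookkeeping over n06-k's landed calculus; legs, factor bounds and (3.105)–(3.106) are HYPOTHESES (schemas); nothing of [B9] asserted;
COUNT-NEUTRAL; N06 NOT discharged; one finite lattice programme — nothing continuum, nothing about OS positivity or the mass gap.
-/

namespace Literature.MathematicalPhysics.QuantumFieldTheory.Balaban1983to89.B9RWSums344InputPairGDir

open Finset B6RandomWalk B6RandomWalkHom B9Thm37Sum B9Thm34Ext B9Thm37Glue B9Thm37Whole B9Cor38Whole B9Thm310Whole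
open B9RWSums343to347Whole B9RWSums346Schur B9Thm37GlueCor36 B9RWSums343Holder B9RWSums344Input B9RWSums344InputGp
open B11SectG B9Thm37AllNorms B9Thm37AllNormsInstances B9SectDL2Decay B9RWSums346SecondDiff B9RWSums346SecondDiffGp B9RWSums346MixedPair
open B9RWSums344InputFam
open B9RWSums344InputPair B9Thm37WholeDir B9Thm310WholeDir

noncomputable section

section Algebra

variable {X : Type}

/-- Algebra of (3.106)∕(3.88) read between a left member and an operator on the right. [folklore] -/
private theorem sandwich_split' {Z : Type} {E : (X → ℝ) →ₗ[ℝ] (Z → ℝ)} {Dst G G0 W : Module.End ℝ (X → ℝ)} (h : G = G0 + G * W) :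
    E ∘ₗ (G ∘ₗ Dst) = E ∘ₗ (G0 ∘ₗ Dst) + (E ∘ₗ G) ∘ₗ (W ∘ₗ Dst) := by
  conv_lhs => rw [h]
  apply LinearMap.ext
  intro f
  simp only [LinearMap.comp_apply, LinearMap.add_apply, Module.End.mul_apply, map_add]

/-- a left member distributes over a finite sum composed on the right. [folklore] -/
private theorem comp_sum_comp' {Z ι : Type} [Fintype ι] (E : (X → ℝ) →ₗ[ℝ] (Z → ℝ)) (Dst : Module.End ℝ (X → ℝ))
    (T : ι → Module.End ℝ (X → ℝ)) : E ∘ₗ ((∑ i, T i) ∘ₗ Dst) = ∑ i, E ∘ₗ (T i ∘ₗ Dst) := by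
  apply LinearMap.ext
  intro f
  simp only [LinearMap.comp_apply, LinearMap.sum_apply, map_sum]

/-- a finite sum of operators composed on the right. [folklore] -/
private theorem sum_comp'' {ι : Type} [Fintype ι] (Dst : Module.End ℝ (X → ℝ)) (T : ι → Module.End ℝ (X → ℝ)) :
    (∑ i, T i) ∘ₗ Dst = ∑ i, T i ∘ₗ Dst := by
  apply LinearMap.ext
  intro f
  simp only [LinearMap.comp_apply, LinearMap.sum_apply]

end Algebra

section GSide

variable {g : B9.Geometry} [Fintype g.Site] [DecidableEq g.Site] {R : ℝ} {H : Prop} {B : B9.Backgrounds}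
variable {X Y ι A P PX PY : Type}

/-- The factors R_a∇\*_μ from `bHX ε`, summed with N_F. [cite: Balaban1985BackgroundPropagators, p.413] -/
private theorem factorsPair_sum [Fintype X] [Fintype A] {𝔬 : Ops310 g B X Y ι A} {𝔡 : DirOps310 𝔬 P}
    {bHX : ℝ → BlockNorm (toB6 g R H) (X → ℝ)} {θI : ℝ → ℝ} {δ₀ : ℝ} {U : B.Cfg} {NF ε : ℝ}
    (hFI : FactorsInputPair310 𝔬 𝔡 R H bHX θI δ₀ U) (hε : 0 < ε) (hθ : 0 ≤ θI ε * g.M⁻¹) (hlen : ∀ y : g.Site, 0 ≤ g.len y)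
    (hcntF : ∀ a : g.Site, (∑ q, if a ∈ 𝔬.SF q then (1 : ℝ) else 0) ≤ NF) (μ : P) :
    HasMaj (bHX ε) (BlockNorm.ofBlocks (toB6 g R H) 𝔬.blk) ((∑ a, 𝔬.Rf U a) ∘ₗ 𝔡.Dsd U μ)
      (fun (y y' : g.Site) => NF * (θI ε * g.M⁻¹) * (g.len y)⁻¹ * Real.exp (-(δ₀ * g.dist y y'))) := by
  rw [sum_comp'']
  have h := hasMaj_localSum (G := toB6 g R H) (fun a => 𝔬.Rf U a ∘ₗ 𝔡.Dsd U μ)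
    (fun a (y : g.Site) => if y ∈ 𝔬.SF a then (1 : ℝ) else 0)
    (fun (y y' : g.Site) => θI ε * g.M⁻¹ * (g.len y)⁻¹ * Real.exp (-(δ₀ * g.dist y y'))) NF
    (fun y y' => mul_nonneg (mul_nonneg hθ (inv_nonneg.mpr (hlen y))) (Real.exp_nonneg _)) (fun a => hFI.facDs ε hε a μ) hcntF
  exact h.mono fun y y' => le_of_eq (by ring)

variable [Fintype P]

/-- ★ **THE (3.44)∕(3.45) MEMBERS OF THE SUM G(U) OF (3.107), PER DIRECTION PAIR** — from (3.106) read as ∇_νG∇\*_μ = Σ_□ ∇_ν(h_□G_□h_□)∇\*_μ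
+ (∇_νG)(R∇\*_μ): the input legs summed with N_I; the COMPONENT ∇_νG of the bundled (3.42) sup majorant C·Lʲη·e^{−δd} (`DirSup310.left`) resp.
the component Φ^X_β∘∇_νG of the bundled (3.43) probe majorant h_c(β)·(Lʲη)^{1−β}·e^{−δd} (`DirSupHolder310.probe`); the factors from `bHX`
summed with N_F; `tail_comp`.  For 0 < ε ≦ 1 (and 0 ≦ β < 1): ∇_νG∇\*_μ : bHX(ε) → sharp blocks has the majorant `inputConst44 …`(ε)·
e^{−(1−α)δd}, and Φ^X_β∘∇_νG∇\*_μ : bHX(β+ε) → probe blocks has `inputConst45 … (h_c β) …`(ε,β)·(Lʲη)^{−β}e^{−(1−α)δd}.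
[cite: Balaban1985BackgroundPropagators, Thm 3.10 (3.105)–(3.108) pp.414–416 + (3.44)–(3.45) p.398 + (3.42)–(3.43) pp.397–398 + p.413; Balaban1984PropagatorsII, (2.52)–(2.55) p.232 + Lemma 2.1 p.234] -/
theorem inputPair3445_of_local310_dir [Fintype X] [DecidableEq X] [Fintype Y] [Fintype ι] [Fintype A] [Fintype PX] [Fintype PY]
    (𝔬 : Ops310 g B X Y ι A) (𝔡 : DirOps310 𝔬 P) (𝔩 : DirLetters310 𝔬 P) (𝔭 : HolderProbes g B X Y PX PY) (R : ℝ) (H : Prop)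
    (bHX : ℝ → BlockNorm (toB6 g R H) (X → ℝ)) (d d₁ : ℕ) (δ α L₀ δ₁ α₁ ρ N N' NF Cℓ NI C : ℝ) (κ : Sizes310)
    (SI : ι → Finset g.Site) (hc BI θI : ℝ → ℝ) (BI2 : ℝ → ℝ → ℝ) (U : B.Cfg)
    (hδ₁ : 0 ≤ δ₁) (hα₁ : 0 ≤ α₁) (hNF : 0 ≤ NF) (hNI : 0 ≤ NI) (hM : 1 ≤ g.M) (hC : 0 ≤ C)
    (hδle : δ ≤ (1 - α₁) * δ₁) (hαδ : 0 ≤ α * δ) (hαδ1 : α * δ ≤ δ)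
    (hs : StaticOK310 𝔬 ρ N N' NF Cℓ κ) (hcntI : ∀ a : g.Site, (∑ i, if a ∈ SI i then (1 : ℝ) else 0) ≤ NI)
    (hhc : ∀ β, 0 ≤ β → β < 1 → 0 ≤ hc β) (hBI : ∀ ε, 0 < ε → ε ≤ 1 → 0 ≤ BI ε)
    (hBI2 : ∀ ε β, 0 < ε → ε ≤ 1 → 0 ≤ β → β < 1 → 0 ≤ BI2 ε β) (hθI : ∀ ε, 0 < ε → 0 ≤ θI ε)
    (h261 : Ineq261 d₁ (toB6 g R H) δ₁ α₁) (hF : Facts347 g R H d δ α L₀) (hi : Identities310₂ 𝔬 𝔡 𝔩 R H U)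
    (hIL : InputLegsPair310 𝔬 𝔡 𝔭 R H bHX SI BI BI2 δ₁ U) (hFI : FactorsInputPair310 𝔬 𝔡 R H bHX θI δ₁ U)
    (hDS : DirSup310 𝔬 𝔡 R H U) (hDH : DirSupHolder310 𝔬 𝔡 𝔭 R H U)
    (h1 : HasMajorantHom (g := toB6 g R H) 𝔬.blk 𝔬.blkY (𝔬.D U ∘ₗ 𝔬.G U)
      (fun (a b : g.Site) => C * g.len a * Real.exp (-(δ * g.dist a b))))
    (hHol : ∀ β : ℝ, 0 ≤ β → β < 1 → HasMajorantHom (g := toB6 g R H) 𝔬.blk 𝔭.blkPY ((𝔭.ΦY U β ∘ₗ 𝔬.D U) ∘ₗ 𝔬.G U)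
      (fun (a b : g.Site) => hc β * g.len a ^ (1 - β) * Real.exp (-(δ * g.dist a b)))) (ν μ : P) :
    (∀ ε : ℝ, 0 < ε → ε ≤ 1 → HasMaj (bHX ε) (BlockNorm.ofBlocks (toB6 g R H) 𝔬.blk) (𝔡.Dd U ν ∘ₗ (𝔬.G U ∘ₗ 𝔡.Dsd U μ))
        (fun (a b : g.Site) => inputConst44 d₁ δ₁ α₁ NI NF C L₀ (BI ε) (θI ε) * Real.exp (-((1 - α) * δ * g.dist a b)))) ∧
      (∀ ε β : ℝ, 0 < ε → ε ≤ 1 → 0 ≤ β → β < 1 →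
        HasMaj (bHX (β + ε)) (BlockNorm.ofBlocks (toB6 g R H) 𝔭.blkPX) (𝔭.ΦX U β ∘ₗ (𝔡.Dd U ν ∘ₗ (𝔬.G U ∘ₗ 𝔡.Dsd U μ)))
          (fun (a b : g.Site) => inputConst45 d₁ δ₁ α₁ NI NF L₀ (hc β) (BI2 ε β) (θI (β + ε)) * g.len a ^ (-β) *
            Real.exp (-((1 - α) * δ * g.dist a b)))) := by
  -- adapted from the sibling's `B9RWSums344Input.input3445_of_local310` (one-slot model), per direction pair
  have hMpos : 0 < g.M := lt_of_lt_of_le one_pos hM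
  have hMinv : g.M⁻¹ ≤ 1 := inv_le_one_of_one_le₀ hM
  have hMinv0 : 0 ≤ g.M⁻¹ := inv_nonneg.mpr hMpos.le
  have hlen0 : ∀ y : g.Site, 0 ≤ g.len y := fun y => (hs.lenpos y).le
  have htri : Triangle254 (toB6 g R H) := fun a b c => hs.tri a b c
  have hc1 : 0 ≤ B6.c1 d₁ δ₁ α₁ := c1_nonneg d₁ δ₁ α₁
  have hL₀ : 0 ≤ L₀ := le_trans (le_trans zero_le_one hF.one_le_L) hF.L_le
  have hαδ₁ : 0 ≤ α₁ * δ₁ := mul_nonneg hα₁ hδ₁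
  have hrate : (1 - α) * δ ≤ (1 - α₁) * δ₁ := by nlinarith [hαδ, hδle]
  have hexp : ∀ a b : g.Site, Real.exp (-(δ₁ * g.dist a b)) ≤ Real.exp (-((1 - α) * δ * g.dist a b)) := fun a b =>
    Real.exp_le_exp.mpr (neg_le_neg (mul_le_mul_of_nonneg_right (by nlinarith [hrate, hαδ₁]) (hs.dnn a b)))
  have hfix : 𝔬.G U = (∑ i, mulOp (𝔬.h i) * 𝔬.Gsq U i * mulOp (𝔬.h i)) + 𝔬.G U * ∑ a, 𝔬.Rf U a :=
    fixedPoint_of_388 hi.inv hi.eq3105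
  refine ⟨fun ε hε0 hε1 => ?_, fun ε β hε0 hε1 hβ0 hβ1 => ?_⟩
  · -- (3.44), pair (ν, μ): ∇_νG∇*_μ = Σ ∇_ν(hGh)∇*_μ + (∇_νG)(R∇*_μ)
    have hθ : 0 ≤ θI ε * g.M⁻¹ := mul_nonneg (hθI ε hε0) hMinv0
    have hP := factorsPair_sum hFI hε0 hθ hlen0 hs.cntF μ
    have hS : HasMajorantHom (g := toB6 g R H) 𝔬.blk 𝔬.blk (𝔡.Dd U ν ∘ₗ 𝔬.G U)
        (fun (a b : g.Site) => C * (g.len a ^ (0 : ℝ) * g.len a) * Real.exp (-(δ * g.dist a b))) :=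
      hasMajorantHom_mono (g := toB6 g R H) 𝔬.blk 𝔬.blk (hDS.left _ h1 ν) fun a b => le_of_eq (by rw [Real.rpow_zero, one_mul])
    have htail := tail_comp (bHX ε) 𝔬.blk 𝔬.blk hF h261 htri hs.symm hs.dnn hs.lenpos hC (mul_nonneg hNF hθ) hαδ1 hrate hS hP
    have hhead := hasMaj_localSum (G := toB6 g R H)
      (fun i => 𝔡.Dd U ν ∘ₗ ((mulOp (𝔬.h i) * 𝔬.Gsq U i * mulOp (𝔬.h i)) ∘ₗ 𝔡.Dsd U μ))
      (fun i (a : g.Site) => if a ∈ SI i then (1 : ℝ) else 0)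
      (fun (a b : g.Site) => BI ε * Real.exp (-(δ₁ * g.dist a b))) NI
      (fun a b => mul_nonneg (hBI ε hε0 hε1) (Real.exp_nonneg _)) (fun i => hIL.e4 ε hε0 hε1 i ν μ) hcntI
    rw [sandwich_split' hfix, comp_sum_comp']
    refine (hhead.add htail).mono fun a b => ?_
    have hK0 : 0 ≤ NI * BI ε := mul_nonneg hNI (hBI ε hε0 hε1)
    have ht : C * (NF * (θI ε * g.M⁻¹)) * L₀ * B6.c1 d₁ δ₁ α₁ ≤ C * (NF * θI ε) * L₀ * B6.c1 d₁ δ₁ α₁ := by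
      have h3 : θI ε * g.M⁻¹ ≤ θI ε := by
        calc θI ε * g.M⁻¹ ≤ θI ε * 1 := mul_le_mul_of_nonneg_left hMinv (hθI ε hε0)
          _ = θI ε := mul_one _
      have h4 : C * (NF * (θI ε * g.M⁻¹)) ≤ C * (NF * θI ε) :=
        mul_le_mul_of_nonneg_left (mul_le_mul_of_nonneg_left h3 hNF) hC
      exact mul_le_mul_of_nonneg_right (mul_le_mul_of_nonneg_right h4 hL₀) hc1
    calc NI * (BI ε * Real.exp (-(δ₁ * g.dist a b))) +
          C * (NF * (θI ε * g.M⁻¹)) * L₀ * B6.c1 d₁ δ₁ α₁ * g.len a ^ (0 : ℝ) * Real.exp (-((1 - α) * δ * g.dist a b))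
        = NI * BI ε * Real.exp (-(δ₁ * g.dist a b)) +
          C * (NF * (θI ε * g.M⁻¹)) * L₀ * B6.c1 d₁ δ₁ α₁ * Real.exp (-((1 - α) * δ * g.dist a b)) := by
          rw [Real.rpow_zero]; ring
      _ ≤ NI * BI ε * Real.exp (-((1 - α) * δ * g.dist a b)) +
          C * (NF * θI ε) * L₀ * B6.c1 d₁ δ₁ α₁ * Real.exp (-((1 - α) * δ * g.dist a b)) :=
          add_le_add (mul_le_mul_of_nonneg_left (hexp a b) hK0) (mul_le_mul_of_nonneg_right ht (Real.exp_nonneg _))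
      _ = inputConst44 d₁ δ₁ α₁ NI NF C L₀ (BI ε) (θI ε) * Real.exp (-((1 - α) * δ * g.dist a b)) := by
          unfold inputConst44; ring
  · -- (3.45), pair (ν, μ): Φ∇_νG∇*_μ = Σ Φ∇_ν(hGh)∇*_μ + (Φ∇_νG)(R∇*_μ)
    have hβε : 0 < β + ε := by linarith
    have hθ : 0 ≤ θI (β + ε) * g.M⁻¹ := mul_nonneg (hθI (β + ε) hβε) hMinv0
    have hP := factorsPair_sum hFI hβε hθ hlen0 hs.cntF μ
    have hHK : 0 ≤ hc β := hhc β hβ0 hβ1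
    have hS : HasMajorantHom (g := toB6 g R H) 𝔬.blk 𝔭.blkPX ((𝔭.ΦX U β ∘ₗ 𝔡.Dd U ν) ∘ₗ 𝔬.G U)
        (fun (a b : g.Site) => hc β * (g.len a ^ (-β) * g.len a) * Real.exp (-(δ * g.dist a b))) := by
      refine hasMajorantHom_mono (g := toB6 g R H) 𝔬.blk 𝔭.blkPX (hDH.probe β _ (hHol β hβ0 hβ1) ν) fun a b => le_of_eq ?_
      have hr : g.len a ^ (1 - β) = g.len a ^ (-β) * g.len a := by
        rw [show (1 - β : ℝ) = -β + 1 by ring, Real.rpow_add (hs.lenpos a), Real.rpow_one]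
      rw [hr]
    have htail := tail_comp (bHX (β + ε)) 𝔬.blk 𝔭.blkPX hF h261 htri hs.symm hs.dnn hs.lenpos hHK (mul_nonneg hNF hθ) hαδ1
      hrate hS hP
    have hhead := hasMaj_localSum (G := toB6 g R H)
      (fun i => (𝔭.ΦX U β ∘ₗ 𝔡.Dd U ν) ∘ₗ ((mulOp (𝔬.h i) * 𝔬.Gsq U i * mulOp (𝔬.h i)) ∘ₗ 𝔡.Dsd U μ))
      (fun i (a : g.Site) => if a ∈ SI i then (1 : ℝ) else 0)
      (fun (a b : g.Site) => BI2 ε β * g.len a ^ (-β) * Real.exp (-(δ₁ * g.dist a b))) NI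
      (fun a b => mul_nonneg (mul_nonneg (hBI2 ε β hε0 hε1 hβ0 hβ1) (Real.rpow_nonneg (hlen0 a) _)) (Real.exp_nonneg _))
      (fun i => hIL.h2 ε β hε0 hε1 hβ0 hβ1 i ν μ) hcntI
    have hassoc : 𝔭.ΦX U β ∘ₗ (𝔡.Dd U ν ∘ₗ (𝔬.G U ∘ₗ 𝔡.Dsd U μ)) = (𝔭.ΦX U β ∘ₗ 𝔡.Dd U ν) ∘ₗ (𝔬.G U ∘ₗ 𝔡.Dsd U μ) := by
      rw [LinearMap.comp_assoc]
    rw [hassoc, sandwich_split' hfix, comp_sum_comp']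
    refine (hhead.add htail).mono fun a b => ?_
    have hW : 0 ≤ g.len a ^ (-β) := Real.rpow_nonneg (hlen0 a) _
    have hK0 : 0 ≤ NI * BI2 ε β * g.len a ^ (-β) := mul_nonneg (mul_nonneg hNI (hBI2 ε β hε0 hε1 hβ0 hβ1)) hW
    have ht : hc β * (NF * (θI (β + ε) * g.M⁻¹)) * L₀ * B6.c1 d₁ δ₁ α₁ ≤ hc β * (NF * θI (β + ε)) * L₀ * B6.c1 d₁ δ₁ α₁ := by
      have h3 : θI (β + ε) * g.M⁻¹ ≤ θI (β + ε) := by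
        calc θI (β + ε) * g.M⁻¹ ≤ θI (β + ε) * 1 := mul_le_mul_of_nonneg_left hMinv (hθI (β + ε) hβε)
          _ = θI (β + ε) := mul_one _
      have h4 : hc β * (NF * (θI (β + ε) * g.M⁻¹)) ≤ hc β * (NF * θI (β + ε)) :=
        mul_le_mul_of_nonneg_left (mul_le_mul_of_nonneg_left h3 hNF) hHK
      exact mul_le_mul_of_nonneg_right (mul_le_mul_of_nonneg_right h4 hL₀) hc1
    calc NI * (BI2 ε β * g.len a ^ (-β) * Real.exp (-(δ₁ * g.dist a b))) +
          hc β * (NF * (θI (β + ε) * g.M⁻¹)) * L₀ * B6.c1 d₁ δ₁ α₁ * g.len a ^ (-β) * Real.exp (-((1 - α) * δ * g.dist a b))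
        = NI * BI2 ε β * g.len a ^ (-β) * Real.exp (-(δ₁ * g.dist a b)) +
          hc β * (NF * (θI (β + ε) * g.M⁻¹)) * L₀ * B6.c1 d₁ δ₁ α₁ * (g.len a ^ (-β) * Real.exp (-((1 - α) * δ * g.dist a b))) := by
          ring
      _ ≤ NI * BI2 ε β * g.len a ^ (-β) * Real.exp (-((1 - α) * δ * g.dist a b)) +
          hc β * (NF * θI (β + ε)) * L₀ * B6.c1 d₁ δ₁ α₁ * (g.len a ^ (-β) * Real.exp (-((1 - α) * δ * g.dist a b))) :=
          add_le_add (mul_le_mul_of_nonneg_left (hexp a b) hK0)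
            (mul_le_mul_of_nonneg_right ht (mul_nonneg hW (Real.exp_nonneg _)))
      _ = inputConst45 d₁ δ₁ α₁ NI NF L₀ (hc β) (BI2 ε β) (θI (β + ε)) * g.len a ^ (-β) *
            Real.exp (-((1 - α) * δ * g.dist a b)) := by
          unfold inputConst45; ring

/-- ★ **THE PACKAGED FAMILY ∇_{U,ν}G∇\*_{U,μ} OVER P × P HAS THE SAME (3.44)∕(3.45) MAJORANTS** from `bHX` into the sharp blocks of
`blk ∘ fst` resp., through the sliced X-probes, into those of `blkPX ∘ fst` (sup sizes: no |P| factor) — the inputs `h44`, `h45` of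
`B9RWSums344InputFam.lines3445_of_hasMaj_fam` for the model of def-Y's `e4`, `h2` at the coordinate pins.
[cite: Balaban1985BackgroundPropagators, (3.44)–(3.45) p.398 + (3.39) p.397 («max_{μ,ν}»)] -/
theorem inputPair3445_family_dir [Fintype X] [DecidableEq X] [Fintype Y] [Fintype ι] [Fintype A] [Fintype PX] [Fintype PY]
    (𝔬 : Ops310 g B X Y ι A) (𝔡 : DirOps310 𝔬 P) (𝔩 : DirLetters310 𝔬 P) (𝔭 : HolderProbes g B X Y PX PY) (R : ℝ) (H : Prop)
    (bHX : ℝ → BlockNorm (toB6 g R H) (X → ℝ)) (d d₁ : ℕ) (δ α L₀ δ₁ α₁ ρ N N' NF Cℓ NI C : ℝ) (κ : Sizes310)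
    (SI : ι → Finset g.Site) (hc BI θI : ℝ → ℝ) (BI2 : ℝ → ℝ → ℝ) (U : B.Cfg)
    (hδ₁ : 0 ≤ δ₁) (hα₁ : 0 ≤ α₁) (hNF : 0 ≤ NF) (hNI : 0 ≤ NI) (hM : 1 ≤ g.M) (hC : 0 ≤ C)
    (hδle : δ ≤ (1 - α₁) * δ₁) (hαδ : 0 ≤ α * δ) (hαδ1 : α * δ ≤ δ)
    (hs : StaticOK310 𝔬 ρ N N' NF Cℓ κ) (hcntI : ∀ a : g.Site, (∑ i, if a ∈ SI i then (1 : ℝ) else 0) ≤ NI)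
    (hhc : ∀ β, 0 ≤ β → β < 1 → 0 ≤ hc β) (hBI : ∀ ε, 0 < ε → ε ≤ 1 → 0 ≤ BI ε)
    (hBI2 : ∀ ε β, 0 < ε → ε ≤ 1 → 0 ≤ β → β < 1 → 0 ≤ BI2 ε β) (hθI : ∀ ε, 0 < ε → 0 ≤ θI ε)
    (h261 : Ineq261 d₁ (toB6 g R H) δ₁ α₁) (hF : Facts347 g R H d δ α L₀) (hi : Identities310₂ 𝔬 𝔡 𝔩 R H U)
    (hIL : InputLegsPair310 𝔬 𝔡 𝔭 R H bHX SI BI BI2 δ₁ U) (hFI : FactorsInputPair310 𝔬 𝔡 R H bHX θI δ₁ U)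
    (hDS : DirSup310 𝔬 𝔡 R H U) (hDH : DirSupHolder310 𝔬 𝔡 𝔭 R H U)
    (h1 : HasMajorantHom (g := toB6 g R H) 𝔬.blk 𝔬.blkY (𝔬.D U ∘ₗ 𝔬.G U)
      (fun (a b : g.Site) => C * g.len a * Real.exp (-(δ * g.dist a b))))
    (hHol : ∀ β : ℝ, 0 ≤ β → β < 1 → HasMajorantHom (g := toB6 g R H) 𝔬.blk 𝔭.blkPY ((𝔭.ΦY U β ∘ₗ 𝔬.D U) ∘ₗ 𝔬.G U)
      (fun (a b : g.Site) => hc β * g.len a ^ (1 - β) * Real.exp (-(δ * g.dist a b)))) :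
    (∀ ε : ℝ, 0 < ε → ε ≤ 1 → HasMaj (bHX ε) (BlockNorm.ofBlocks (toB6 g R H) (𝔬.blk ∘ Prod.fst))
        (familyOp fun p : P × P => 𝔡.Dd U p.1 ∘ₗ (𝔬.G U ∘ₗ 𝔡.Dsd U p.2))
        (fun (a b : g.Site) => inputConst44 d₁ δ₁ α₁ NI NF C L₀ (BI ε) (θI ε) * Real.exp (-((1 - α) * δ * g.dist a b)))) ∧
      (∀ ε β : ℝ, 0 < ε → ε ≤ 1 → 0 ≤ β → β < 1 →
        HasMaj (bHX (β + ε)) (BlockNorm.ofBlocks (toB6 g R H) (𝔭.blkPX ∘ Prod.fst))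
          (sliceProbe (𝔭.ΦX U β) ∘ₗ familyOp fun p : P × P => 𝔡.Dd U p.1 ∘ₗ (𝔬.G U ∘ₗ 𝔡.Dsd U p.2))
          (fun (a b : g.Site) => inputConst45 d₁ δ₁ α₁ NI NF L₀ (hc β) (BI2 ε β) (θI (β + ε)) * g.len a ^ (-β) *
            Real.exp (-((1 - α) * δ * g.dist a b)))) := by
  have hL₀ : 0 ≤ L₀ := le_trans (le_trans zero_le_one hF.one_le_L) hF.L_le
  have hc1 : 0 ≤ B6.c1 d₁ δ₁ α₁ := c1_nonneg d₁ δ₁ α₁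
  have hlen0 : ∀ y : g.Site, 0 ≤ g.len y := fun y => (hs.lenpos y).le
  have hpair := fun p : P × P => inputPair3445_of_local310_dir 𝔬 𝔡 𝔩 𝔭 R H bHX d d₁ δ α L₀ δ₁ α₁ ρ N N' NF Cℓ NI C κ SI hc BI θI BI2
    U hδ₁ hα₁ hNF hNI hM hC hδle hαδ hαδ1 hs hcntI hhc hBI hBI2 hθI h261 hF hi hIL hFI hDS hDH h1 hHol p.1 p.2
  refine ⟨fun ε hε0 hε1 => ?_, fun ε β hε0 hε1 hβ0 hβ1 => ?_⟩
  · have hK : ∀ a b : g.Site, 0 ≤ inputConst44 d₁ δ₁ α₁ NI NF C L₀ (BI ε) (θI ε) * Real.exp (-((1 - α) * δ * g.dist a b)) := by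
      intro a b
      have h1' := hBI ε hε0 hε1
      have h2' := hθI ε hε0
      unfold inputConst44
      positivity
    exact hasMaj_familyOp' (R := R) (H := H) 𝔬.blk hK fun p => (hpair p).1 ε hε0 hε1
  · have hK : ∀ a b : g.Site, 0 ≤ inputConst45 d₁ δ₁ α₁ NI NF L₀ (hc β) (BI2 ε β) (θI (β + ε)) * g.len a ^ (-β) *
        Real.exp (-((1 - α) * δ * g.dist a b)) := by
      intro a b
      have h1' := hBI2 ε β hε0 hε1 hβ0 hβ1
      have h2' := hθI (β + ε) (by linarith)
      have h3' := hhc β hβ0 hβ1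
      have h4' : 0 ≤ g.len a ^ (-β) := Real.rpow_nonneg (hlen0 a) _
      unfold inputConst45
      positivity
    rw [sliceProbe_comp_familyOp]
    exact hasMaj_familyOp' (R := R) (H := H) 𝔭.blkPX hK fun p => (hpair p).2 ε β hε0 hε1 hβ0 hβ1

end GSide

end

end Literature.MathematicalPhysics.QuantumFieldTheory.Balaban1983to89.B9RWSums344InputPairGDir
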